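import Mathlib
import Summits.Ventures.HodgeRepro.Tier4.Line4.ArchFourierTorus
import Summits.Ventures.HodgeRepro.Tier4.Line4.ArchBallProduct
import Summits.Ventures.HodgeRepro.Tier4.Common.ArchAssembleProd

/-!
# Tier4/Line4/KTypeIntegers — C-L4-KTYPE-INTEGERS (plan-4 g8 S16358 (3)): the K-type identity of the identity-instance
reduction of `hF` unfolded to the DISPLAYED integers at `g = g′ = 1`

Blind re-derivation cell `pub-hodge-repro`, Tier 4 «prove the step» (README §9–§10), seat t4-L4-x2 (extra prover, LINE L4,
gen 2; cut by name S16358 (3), TAKEN S16361).  Target tree path `lean/Summits/Ventures/HodgeRepro/Tier4/Line4/KTypeIntegers.lean`.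
On part 2 (Tier4/Line4/ArchFourierTorus p719042: `torusT'_withTransportedTorus_one`), typer-2's RowWeights
(`weightAt'_eq_weightAt_of_mat`, `weightAt_mul`, `weightAt_one`, `norm_weightAt_eq_one`), ArchAssemble / ArchAssembleProd
(p706585 / p707004: `ofPlace_mem_localTorusAt`, `map_subtype_eq_prod_ofPlace_torusT`), L1-p2's ArchBallProduct
(`mem_infinitePart_iff_finiteComponent`), L1-p5's TorusWeightLocal (`torusWeight'_of_mem_localTorusAt'`, `torusWeight'_mul`);
no printed input.

THE OBJECT.  At the identity instance (`g = g′ = 1`: `T′ = T`, part 2), the archimedean conjunct `hF` of the `γ₀`-existence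
display is `(∀ t : T_∞, χ(t) · Wt(t⁻¹) = 1) ∧ archWitnessOf γ₀ ≠ 0` (`integral_chi_archWitnessOf_ne_zero_iff_of_one`).
This module reads the first conjunct — the K-TYPE IDENTITY — through the wall's own binder
`_hchi : ∀ w, ChiMatchesAt W q w (eP w) (eM w) R.chi` and proves, with NO definition (kernel lane):

* `weightAt'_one_one`: at `g = g′ = 1` the transported weights are the weights (`Q i = 1 · P i · 1`), and
  `localTorusAt'_withTransportedTorus_one`: the transported local tori are the local tori;
* `torusWeight'_one_one_of_mem_localTorusAt`: on the local torus `T_w`, `Wt(κ) = u₀(κ)^{−eP′ w} · u₁(κ)^{−eM′ w}`;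
* `chi_mul_torusWeight'_inv_of_mem_localTorusAt`: on `T_w`, through `_hchi`,
  `χ(κ) · Wt(κ⁻¹) = u₀(κ)^{eP′ w − eP w} · u₁(κ)^{eM′ w − eM w}`;
* `forall_chi_mul_torusWeight'_inv_eq_one_iff_local`: the identity on all of `T_∞` ⟺ the identity on every local torus
  `T_w` (the place split `χψ(t) = ∏_w χψ(ofPlace w t)` of ArchAssembleProd; `ψ` multiplicative by `chi_mul` + `torusWeight'_mul`);
* **`forall_chi_mul_torusWeight'_inv_eq_one_iff_weights`** — THE DISPLAYED-INTEGERS FORM: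
  `(∀ t : T_∞, χ(t) · Wt(t⁻¹) = 1) ↔ ∀ w, ∀ κ ∈ T_w, u₀(κ)^{eP′ w − eP w} · u₁(κ)^{eM′ w − eM w} = 1`;
* **`forall_chi_mul_torusWeight'_inv_eq_one_iff_integers`** — under the LOCAL-TORUS SURJECTIVITY hypothesis `hsurj` (every
  unit complex number is a weight `u₀` (resp. `u₁`) of some element of `T_w` with the other weight `1` — the typer-class
  fact «`T_w ≅ U(1) × U(1)`», NOT proved here), the identity is EXACTLY `∀ w, eP′ w = eP w ∧ eM′ w = eM w`
  (`exp (π i / m)^m = −1 ≠ 1` for `m ≠ 0`).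

READING.  At `g = 1` the K-type conjunct of `hF` is a finite check on the wall's displayed integers: the two displayed
weight pairs must COINCIDE at every infinite place (given `hsurj`); no choice of `γ₀` enters.  Nothing here says anything
about the status of the Hodge conjecture for CM abelian varieties, which is NOT proved (HC_CM is NOT proved by anyone in
this repository).
-/

set_option autoImplicit false

noncomputable section

namespace Summit.Ventures.HodgeRepro.Tier4.Line4

open Summit.Ventures.HodgeRepro.Tier4.Common Summit.Ventures.HodgeRepro.Tier4.Line1 NumberField Matrix MeasureTheory

open scoped ComplexConjugate

open scoped Classical

section Identity

variable {k : Type} [Field k] [NumberField k] (q : QuadData k) (a : Fin 4 → k)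
  (hgg' : (1 : Matrix (Fin 4) (Fin 4) k) * 1 = 1) (hg'g : (1 : Matrix (Fin 4) (Fin 4) k) * 1 = 1)
  (hgΩ : (1 : Matrix (Fin 4) (Fin 4) k) * (PlaneData.mixedRow q (a 0) (a 2)).Ω = (PlaneData.mixedRow q (a 0) (a 2)).Ω * 1)

/-- **at `g = g′ = 1` the transported weights are the weights** (`entryAtConj` with `g = g′ = 1` is `entryAt`). -/
theorem weightAt'_one_one (w : InfinitePlace k) (j : Fin 2) (κ : GA ((PlaneData.mixedRow q (a 0) (a 2)).withTransportedTorus 1 1 hgg' hg'g hgΩ)) :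
    weightAt' ((PlaneData.mixedRow q (a 0) (a 2)).withTransportedTorus 1 1 hgg' hg'g hgΩ) q w 1 1 j κ = weightAt ((PlaneData.mixedRow q (a 0) (a 2)).withTransportedTorus 1 1 hgg' hg'g hgΩ) q w j κ :=
  weightAt'_eq_weightAt_of_mat q w _ _ 1 1 κ κ (by rw [adMat_one, Matrix.one_mul, Matrix.mul_one]) j

/-- **at `g = g′ = 1` the transported local tori are the local tori** (`torusT'_withTransportedTorus_one`). -/
theorem localTorusAt'_withTransportedTorus_one (w : InfinitePlace k) :
    localTorusAt' ((PlaneData.mixedRow q (a 0) (a 2)).withTransportedTorus 1 1 hgg' hg'g hgΩ) w = localTorusAt ((PlaneData.mixedRow q (a 0) (a 2)).withTransportedTorus 1 1 hgg' hg'g hgΩ) w := by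
  unfold localTorusAt' localTorusAt
  rw [torusT'_withTransportedTorus_one]

variable (lam : k) (hlam : lam ≠ 0)
  (hiso : (1 : Matrix (Fin 4) (Fin 4) k) * (PlaneData.mixedRow q (a 1) (a 3)).B * (1 : Matrix (Fin 4) (Fin 4) k)ᵀ =
    lam • (PlaneData.mixedRow q (a 0) (a 2)).B)
  (eP eM eP' eM' : InfinitePlace k → ℤ)

include lam hlam hiso in
/-- **`Wt` on the local torus `T_w` at `g = g′ = 1`**: `Wt(κ) = u₀(κ)^{−eP′ w} · u₁(κ)^{−eM′ w}` (TorusWeightLocal's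
`torusWeight'_of_mem_localTorusAt'` through the two identifications above). -/
theorem torusWeight'_one_one_of_mem_localTorusAt {w : InfinitePlace k} {κ : GA ((PlaneData.mixedRow q (a 0) (a 2)).withTransportedTorus 1 1 hgg' hg'g hgΩ)}
    (hκ : κ ∈ localTorusAt ((PlaneData.mixedRow q (a 0) (a 2)).withTransportedTorus 1 1 hgg' hg'g hgΩ) w) :
    torusWeight' q a 1 1 hgg' hg'g hgΩ eP' eM' κ = weightAt ((PlaneData.mixedRow q (a 0) (a 2)).withTransportedTorus 1 1 hgg' hg'g hgΩ) q w 0 κ ^ (-eP' w) * weightAt ((PlaneData.mixedRow q (a 0) (a 2)).withTransportedTorus 1 1 hgg' hg'g hgΩ) q w 1 κ ^ (-eM' w) := by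
  have hκ' : κ ∈ localTorusAt' ((PlaneData.mixedRow q (a 0) (a 2)).withTransportedTorus 1 1 hgg' hg'g hgΩ) w := by
    rw [localTorusAt'_withTransportedTorus_one]
    exact hκ
  rw [torusWeight'_of_mem_localTorusAt' q a 1 1 hgg' hg'g hgΩ lam hlam hiso eP' eM' hκ', weightAt'_one_one,
    weightAt'_one_one]

end Identity

section RowPlane

variable {k : Type} [Field k] [NumberField k] (q : QuadData k) (a b ε : k) (w : InfinitePlace k)

/-- the weights are units on the torus of a row plane: `u_j(κ) ≠ 0` for `κ ∈ T` (`norm_weightAt_eq_one`). -/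
theorem weightAt_ne_zero_of_mem_torusT_row (ha : a ≠ 0) (hb : b ≠ 0) (hε : ε ≠ 0) (hw : w.IsReal) (hcm : IsCMAt q w)
    (j : Fin 2) {κ : GA (PlaneData.ofLinesRow q a b ε)} (hκ : κ ∈ torusT (PlaneData.ofLinesRow q a b ε)) :
    weightAt (PlaneData.ofLinesRow q a b ε) q w j κ ≠ 0 := by
  intro h0
  have h := norm_weightAt_eq_one q a b ε w ha hb hε hw hcm j hκ
  rw [h0, norm_zero] at h
  exact zero_ne_one h

/-- `u_j(κ⁻¹) = u_j(κ)⁻¹` on the torus of a row plane (`weightAt_mul` + `weightAt_one`). -/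
theorem weightAt_inv_of_mem_torusT_row (ha : a ≠ 0) (hb : b ≠ 0) (hε : ε ≠ 0) (hw : w.IsReal) (hcm : IsCMAt q w)
    (j : Fin 2) {κ : GA (PlaneData.ofLinesRow q a b ε)} (hκ : κ ∈ torusT (PlaneData.ofLinesRow q a b ε)) :
    weightAt (PlaneData.ofLinesRow q a b ε) q w j κ⁻¹ = (weightAt (PlaneData.ofLinesRow q a b ε) q w j κ)⁻¹ := by
  have hmul := weightAt_mul q a b ε w ha hb hε hw hcm j hκ ((torusT (PlaneData.ofLinesRow q a b ε)).inv_mem hκ)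
  rw [mul_inv_cancel, weightAt_one] at hmul
  exact eq_inv_of_mul_eq_one_right hmul.symm

end RowPlane

section Identity2

variable {k : Type} [Field k] [NumberField k] (q : QuadData k) (a : Fin 4 → k)
  (hgg' : (1 : Matrix (Fin 4) (Fin 4) k) * 1 = 1) (hg'g : (1 : Matrix (Fin 4) (Fin 4) k) * 1 = 1)
  (hgΩ : (1 : Matrix (Fin 4) (Fin 4) k) * (PlaneData.mixedRow q (a 0) (a 2)).Ω = (PlaneData.mixedRow q (a 0) (a 2)).Ω * 1)

/-- the weights are units on the torus of the (transported, `g = 1`) seesaw plane — the row-plane lemma read on the same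
group with the same entries. -/
theorem weightAt_ne_zero_of_mem_torusT (ha0 : a 0 ≠ 0) (ha2 : a 2 ≠ 0) (w : InfinitePlace k) (hw : w.IsReal)
    (hcm : IsCMAt q w) (j : Fin 2) {κ : GA ((PlaneData.mixedRow q (a 0) (a 2)).withTransportedTorus 1 1 hgg' hg'g hgΩ)} (hκ : κ ∈ torusT ((PlaneData.mixedRow q (a 0) (a 2)).withTransportedTorus 1 1 hgg' hg'g hgΩ)) :
    weightAt ((PlaneData.mixedRow q (a 0) (a 2)).withTransportedTorus 1 1 hgg' hg'g hgΩ) q w j κ ≠ 0 :=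
  weightAt_ne_zero_of_mem_torusT_row q (a 0) (a 2) (-1) w ha0 ha2 (by norm_num) hw hcm j (κ := (κ : GA (PlaneData.ofLinesRow q (a 0) (a 2) (-1)))) hκ

/-- `u_j(κ⁻¹) = u_j(κ)⁻¹` on the torus of the (transported, `g = 1`) seesaw plane. -/
theorem weightAt_inv_of_mem_torusT (ha0 : a 0 ≠ 0) (ha2 : a 2 ≠ 0) (w : InfinitePlace k) (hw : w.IsReal)
    (hcm : IsCMAt q w) (j : Fin 2) {κ : GA ((PlaneData.mixedRow q (a 0) (a 2)).withTransportedTorus 1 1 hgg' hg'g hgΩ)} (hκ : κ ∈ torusT ((PlaneData.mixedRow q (a 0) (a 2)).withTransportedTorus 1 1 hgg' hg'g hgΩ)) :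
    weightAt ((PlaneData.mixedRow q (a 0) (a 2)).withTransportedTorus 1 1 hgg' hg'g hgΩ) q w j κ⁻¹ = (weightAt ((PlaneData.mixedRow q (a 0) (a 2)).withTransportedTorus 1 1 hgg' hg'g hgΩ) q w j κ)⁻¹ :=
  weightAt_inv_of_mem_torusT_row q (a 0) (a 2) (-1) w ha0 ha2 (by norm_num) hw hcm j (κ := (κ : GA (PlaneData.ofLinesRow q (a 0) (a 2) (-1)))) hκ

variable (lam : k) (hlam : lam ≠ 0)
  (hiso : (1 : Matrix (Fin 4) (Fin 4) k) * (PlaneData.mixedRow q (a 1) (a 3)).B * (1 : Matrix (Fin 4) (Fin 4) k)ᵀ =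
    lam • (PlaneData.mixedRow q (a 0) (a 2)).B)
  (eP eM eP' eM' : InfinitePlace k → ℤ)

include lam hlam hiso in
/-- **the K-type character on the local torus, through the wall's `_hchi`**: for `κ ∈ T_w`,
`χ(κ) · Wt(κ⁻¹) = u₀(κ)^{eP′ w − eP w} · u₁(κ)^{eM′ w − eM w}`. -/
theorem chi_mul_torusWeight'_inv_of_mem_localTorusAt [MeasurableSpace (GA ((PlaneData.mixedRow q (a 0) (a 2)).withTransportedTorus 1 1 hgg' hg'g hgΩ))] (R : RTFData ((PlaneData.mixedRow q (a 0) (a 2)).withTransportedTorus 1 1 hgg' hg'g hgΩ))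
    (ha0 : a 0 ≠ 0) (ha2 : a 2 ≠ 0) {w : InfinitePlace k} (hw : w.IsReal) (hcm : IsCMAt q w)
    (hchi : ChiMatchesAt ((PlaneData.mixedRow q (a 0) (a 2)).withTransportedTorus 1 1 hgg' hg'g hgΩ) q w (eP w) (eM w) R.chi) (κ : torusT ((PlaneData.mixedRow q (a 0) (a 2)).withTransportedTorus 1 1 hgg' hg'g hgΩ))
    (hκ : (κ : GA ((PlaneData.mixedRow q (a 0) (a 2)).withTransportedTorus 1 1 hgg' hg'g hgΩ)) ∈ localTorusAt ((PlaneData.mixedRow q (a 0) (a 2)).withTransportedTorus 1 1 hgg' hg'g hgΩ) w) :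
    R.chi κ * torusWeight' q a 1 1 hgg' hg'g hgΩ eP' eM' ((κ : GA ((PlaneData.mixedRow q (a 0) (a 2)).withTransportedTorus 1 1 hgg' hg'g hgΩ)))⁻¹ =
      weightAt ((PlaneData.mixedRow q (a 0) (a 2)).withTransportedTorus 1 1 hgg' hg'g hgΩ) q w 0 (κ : GA ((PlaneData.mixedRow q (a 0) (a 2)).withTransportedTorus 1 1 hgg' hg'g hgΩ)) ^ (eP' w - eP w) * weightAt ((PlaneData.mixedRow q (a 0) (a 2)).withTransportedTorus 1 1 hgg' hg'g hgΩ) q w 1 (κ : GA ((PlaneData.mixedRow q (a 0) (a 2)).withTransportedTorus 1 1 hgg' hg'g hgΩ)) ^ (eM' w - eM w) := by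
  have hκT : (κ : GA ((PlaneData.mixedRow q (a 0) (a 2)).withTransportedTorus 1 1 hgg' hg'g hgΩ)) ∈ torusT ((PlaneData.mixedRow q (a 0) (a 2)).withTransportedTorus 1 1 hgg' hg'g hgΩ) := hκ.1
  have hκinv : ((κ : GA ((PlaneData.mixedRow q (a 0) (a 2)).withTransportedTorus 1 1 hgg' hg'g hgΩ)))⁻¹ ∈ localTorusAt ((PlaneData.mixedRow q (a 0) (a 2)).withTransportedTorus 1 1 hgg' hg'g hgΩ) w := (localTorusAt ((PlaneData.mixedRow q (a 0) (a 2)).withTransportedTorus 1 1 hgg' hg'g hgΩ) w).inv_mem hκ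
  have h0 := weightAt_ne_zero_of_mem_torusT q a hgg' hg'g hgΩ ha0 ha2 w hw hcm 0 hκT
  have h1 := weightAt_ne_zero_of_mem_torusT q a hgg' hg'g hgΩ ha0 ha2 w hw hcm 1 hκT
  have hchiκ := hchi κ hκ
  have hchi' : R.chi κ = (weightAt ((PlaneData.mixedRow q (a 0) (a 2)).withTransportedTorus 1 1 hgg' hg'g hgΩ) q w 0 (κ : GA ((PlaneData.mixedRow q (a 0) (a 2)).withTransportedTorus 1 1 hgg' hg'g hgΩ)) ^ (eP w) * weightAt ((PlaneData.mixedRow q (a 0) (a 2)).withTransportedTorus 1 1 hgg' hg'g hgΩ) q w 1 (κ : GA ((PlaneData.mixedRow q (a 0) (a 2)).withTransportedTorus 1 1 hgg' hg'g hgΩ)) ^ (eM w))⁻¹ := by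
    rw [mul_assoc] at hchiκ
    exact eq_inv_of_mul_eq_one_left hchiκ
  rw [hchi', torusWeight'_one_one_of_mem_localTorusAt q a hgg' hg'g hgΩ lam hlam hiso eP' eM' hκinv,
    weightAt_inv_of_mem_torusT q a hgg' hg'g hgΩ ha0 ha2 w hw hcm 0 hκT, weightAt_inv_of_mem_torusT q a hgg' hg'g hgΩ ha0 ha2 w hw hcm 1 hκT,
    _root_.inv_zpow', _root_.inv_zpow', neg_neg, neg_neg, zpow_sub₀ h0, zpow_sub₀ h1]
  ring

include lam hlam hiso in
/-- **global ⟺ local**: the K-type identity on all of `T_∞` ⟺ on every local torus `T_w` (the place split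
`ψ(t) = ∏_w ψ(ofPlace w t)` of ArchAssembleProd; `ψ(κ) := χ(κ) · Wt(κ⁻¹)` is a character of `T(𝔸)` since `T = T′`). -/
theorem forall_chi_mul_torusWeight'_inv_eq_one_iff_local [MeasurableSpace (GA ((PlaneData.mixedRow q (a 0) (a 2)).withTransportedTorus 1 1 hgg' hg'g hgΩ))] (R : RTFData ((PlaneData.mixedRow q (a 0) (a 2)).withTransportedTorus 1 1 hgg' hg'g hgΩ))
    (hall : ∀ w : InfinitePlace k, w.IsReal ∧ IsCMAt q w) (ha1 : a 1 ≠ 0) (ha3 : a 3 ≠ 0) :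
    (∀ t : torusInf ((PlaneData.mixedRow q (a 0) (a 2)).withTransportedTorus 1 1 hgg' hg'g hgΩ), R.chi t * torusWeight' q a 1 1 hgg' hg'g hgΩ eP' eM' (((t : torusT ((PlaneData.mixedRow q (a 0) (a 2)).withTransportedTorus 1 1 hgg' hg'g hgΩ)) : GA ((PlaneData.mixedRow q (a 0) (a 2)).withTransportedTorus 1 1 hgg' hg'g hgΩ)))⁻¹ = 1) ↔
      ∀ w : InfinitePlace k, ∀ κ : torusT ((PlaneData.mixedRow q (a 0) (a 2)).withTransportedTorus 1 1 hgg' hg'g hgΩ), (κ : GA ((PlaneData.mixedRow q (a 0) (a 2)).withTransportedTorus 1 1 hgg' hg'g hgΩ)) ∈ localTorusAt ((PlaneData.mixedRow q (a 0) (a 2)).withTransportedTorus 1 1 hgg' hg'g hgΩ) w →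
        R.chi κ * torusWeight' q a 1 1 hgg' hg'g hgΩ eP' eM' ((κ : GA ((PlaneData.mixedRow q (a 0) (a 2)).withTransportedTorus 1 1 hgg' hg'g hgΩ)))⁻¹ = 1 := by
  have hle : torusT ((PlaneData.mixedRow q (a 0) (a 2)).withTransportedTorus 1 1 hgg' hg'g hgΩ) ≤ torusT' ((PlaneData.mixedRow q (a 0) (a 2)).withTransportedTorus 1 1 hgg' hg'g hgΩ) := le_of_eq (torusT'_withTransportedTorus_one q a hgg' hg'g hgΩ).symm
  constructor
  · intro h w κ hκ
    have hinf : (κ : GA ((PlaneData.mixedRow q (a 0) (a 2)).withTransportedTorus 1 1 hgg' hg'g hgΩ)) ∈ infinitePart ((PlaneData.mixedRow q (a 0) (a 2)).withTransportedTorus 1 1 hgg' hg'g hgΩ) :=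
      (mem_infinitePart_iff_finiteComponent ((PlaneData.mixedRow q (a 0) (a 2)).withTransportedTorus 1 1 hgg' hg'g hgΩ) _).2 hκ.2.1
    exact h ⟨κ, Subgroup.mem_subgroupOf.2 hinf⟩
  · intro h t
    have ht : ((t : torusT ((PlaneData.mixedRow q (a 0) (a 2)).withTransportedTorus 1 1 hgg' hg'g hgΩ)) : GA ((PlaneData.mixedRow q (a 0) (a 2)).withTransportedTorus 1 1 hgg' hg'g hgΩ)) ∈ torusT ((PlaneData.mixedRow q (a 0) (a 2)).withTransportedTorus 1 1 hgg' hg'g hgΩ) := (t : torusT ((PlaneData.mixedRow q (a 0) (a 2)).withTransportedTorus 1 1 hgg' hg'g hgΩ)).2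
    have hinf : ((t : torusT ((PlaneData.mixedRow q (a 0) (a 2)).withTransportedTorus 1 1 hgg' hg'g hgΩ)) : GA ((PlaneData.mixedRow q (a 0) (a 2)).withTransportedTorus 1 1 hgg' hg'g hgΩ)) ∈ infinitePart ((PlaneData.mixedRow q (a 0) (a 2)).withTransportedTorus 1 1 hgg' hg'g hgΩ) := Subgroup.mem_subgroupOf.1 t.2
    have hψ1 : R.chi (1 : torusT ((PlaneData.mixedRow q (a 0) (a 2)).withTransportedTorus 1 1 hgg' hg'g hgΩ)) * torusWeight' q a 1 1 hgg' hg'g hgΩ eP' eM' (((1 : torusT ((PlaneData.mixedRow q (a 0) (a 2)).withTransportedTorus 1 1 hgg' hg'g hgΩ)) : GA ((PlaneData.mixedRow q (a 0) (a 2)).withTransportedTorus 1 1 hgg' hg'g hgΩ)))⁻¹ = 1 := by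
      rw [R.chi_rational 1 (by rw [OneMemClass.coe_one]; exact (rationalPoints ((PlaneData.mixedRow q (a 0) (a 2)).withTransportedTorus 1 1 hgg' hg'g hgΩ)).one_mem), OneMemClass.coe_one,
        inv_one, torusWeight'_one q a 1 1 hgg' hg'g hgΩ lam hiso eP' eM', mul_one]
    have hψmul : ∀ s u : torusT ((PlaneData.mixedRow q (a 0) (a 2)).withTransportedTorus 1 1 hgg' hg'g hgΩ),
        R.chi (s * u) * torusWeight' q a 1 1 hgg' hg'g hgΩ eP' eM' (((s * u : torusT ((PlaneData.mixedRow q (a 0) (a 2)).withTransportedTorus 1 1 hgg' hg'g hgΩ)) : GA ((PlaneData.mixedRow q (a 0) (a 2)).withTransportedTorus 1 1 hgg' hg'g hgΩ)))⁻¹ =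
          (R.chi s * torusWeight' q a 1 1 hgg' hg'g hgΩ eP' eM' ((s : GA ((PlaneData.mixedRow q (a 0) (a 2)).withTransportedTorus 1 1 hgg' hg'g hgΩ)))⁻¹) * (R.chi u * torusWeight' q a 1 1 hgg' hg'g hgΩ eP' eM' ((u : GA ((PlaneData.mixedRow q (a 0) (a 2)).withTransportedTorus 1 1 hgg' hg'g hgΩ)))⁻¹) := by
      intro s u
      rw [R.chi_mul, Subgroup.coe_mul, _root_.mul_inv_rev, torusWeight'_mul q a 1 1 hgg' hg'g hgΩ lam hlam hiso hall ha1
        ha3 eP' eM' ((torusT' ((PlaneData.mixedRow q (a 0) (a 2)).withTransportedTorus 1 1 hgg' hg'g hgΩ)).inv_mem (hle u.2)) ((torusT' ((PlaneData.mixedRow q (a 0) (a 2)).withTransportedTorus 1 1 hgg' hg'g hgΩ)).inv_mem (hle s.2))]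
      ring
    let ψ : torusT ((PlaneData.mixedRow q (a 0) (a 2)).withTransportedTorus 1 1 hgg' hg'g hgΩ) →* ℂ := ⟨⟨fun κ => R.chi κ * torusWeight' q a 1 1 hgg' hg'g hgΩ eP' eM' ((κ : GA ((PlaneData.mixedRow q (a 0) (a 2)).withTransportedTorus 1 1 hgg' hg'g hgΩ)))⁻¹, hψ1⟩, hψmul⟩
    have hsplit := map_subtype_eq_prod_ofPlace_torusT ((PlaneData.mixedRow q (a 0) (a 2)).withTransportedTorus 1 1 hgg' hg'g hgΩ) ψ hinf ht
    show ψ (t : torusT ((PlaneData.mixedRow q (a 0) (a 2)).withTransportedTorus 1 1 hgg' hg'g hgΩ)) = 1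
    rw [hsplit]
    refine Finset.prod_eq_one fun w _ => ?_
    exact h w _ (ofPlace_mem_localTorusAt ((PlaneData.mixedRow q (a 0) (a 2)).withTransportedTorus 1 1 hgg' hg'g hgΩ) w ht)

include lam hlam hiso in
/-- **THE DISPLAYED-INTEGERS FORM (weights)**: through the wall's `_hchi`, the K-type identity of
`integral_chi_archWitnessOf_ne_zero_iff_of_one` is
`∀ w, ∀ κ ∈ T_w, u₀(κ)^{eP′ w − eP w} · u₁(κ)^{eM′ w − eM w} = 1`. -/
theorem forall_chi_mul_torusWeight'_inv_eq_one_iff_weights [MeasurableSpace (GA ((PlaneData.mixedRow q (a 0) (a 2)).withTransportedTorus 1 1 hgg' hg'g hgΩ))] (R : RTFData ((PlaneData.mixedRow q (a 0) (a 2)).withTransportedTorus 1 1 hgg' hg'g hgΩ))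
    (hall : ∀ w : InfinitePlace k, w.IsReal ∧ IsCMAt q w) (ha0 : a 0 ≠ 0) (ha2 : a 2 ≠ 0) (ha1 : a 1 ≠ 0)
    (ha3 : a 3 ≠ 0) (hchi : ∀ w, ChiMatchesAt ((PlaneData.mixedRow q (a 0) (a 2)).withTransportedTorus 1 1 hgg' hg'g hgΩ) q w (eP w) (eM w) R.chi) :
    (∀ t : torusInf ((PlaneData.mixedRow q (a 0) (a 2)).withTransportedTorus 1 1 hgg' hg'g hgΩ), R.chi t * torusWeight' q a 1 1 hgg' hg'g hgΩ eP' eM' (((t : torusT ((PlaneData.mixedRow q (a 0) (a 2)).withTransportedTorus 1 1 hgg' hg'g hgΩ)) : GA ((PlaneData.mixedRow q (a 0) (a 2)).withTransportedTorus 1 1 hgg' hg'g hgΩ)))⁻¹ = 1) ↔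
      ∀ w : InfinitePlace k, ∀ κ : torusT ((PlaneData.mixedRow q (a 0) (a 2)).withTransportedTorus 1 1 hgg' hg'g hgΩ), (κ : GA ((PlaneData.mixedRow q (a 0) (a 2)).withTransportedTorus 1 1 hgg' hg'g hgΩ)) ∈ localTorusAt ((PlaneData.mixedRow q (a 0) (a 2)).withTransportedTorus 1 1 hgg' hg'g hgΩ) w →
        weightAt ((PlaneData.mixedRow q (a 0) (a 2)).withTransportedTorus 1 1 hgg' hg'g hgΩ) q w 0 (κ : GA ((PlaneData.mixedRow q (a 0) (a 2)).withTransportedTorus 1 1 hgg' hg'g hgΩ)) ^ (eP' w - eP w) * weightAt ((PlaneData.mixedRow q (a 0) (a 2)).withTransportedTorus 1 1 hgg' hg'g hgΩ) q w 1 (κ : GA ((PlaneData.mixedRow q (a 0) (a 2)).withTransportedTorus 1 1 hgg' hg'g hgΩ)) ^ (eM' w - eM w) = 1 := by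
  rw [forall_chi_mul_torusWeight'_inv_eq_one_iff_local q a hgg' hg'g hgΩ lam hlam hiso eP' eM' R hall ha1 ha3]
  constructor
  · intro h w κ hκ
    rw [← chi_mul_torusWeight'_inv_of_mem_localTorusAt q a hgg' hg'g hgΩ lam hlam hiso eP eM eP' eM' R ha0 ha2 (hall w).1
      (hall w).2 (hchi w) κ hκ]
    exact h w κ hκ
  · intro h w κ hκ
    rw [chi_mul_torusWeight'_inv_of_mem_localTorusAt q a hgg' hg'g hgΩ lam hlam hiso eP eM eP' eM' R ha0 ha2 (hall w).1
      (hall w).2 (hchi w) κ hκ]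
    exact h w κ hκ

/-- `exp ((π / m) i) ^ m = −1` for an integer `m ≠ 0` (the unit that detects a non-zero exponent). -/
theorem exp_pi_div_mul_I_zpow {m : ℤ} (hm : m ≠ 0) :
    Complex.exp (((Real.pi / m : ℝ) : ℂ) * Complex.I) ^ m = -1 := by
  rw [← Complex.exp_int_mul, ← Complex.exp_pi_mul_I]
  congr 1
  have hm' : (m : ℂ) ≠ 0 := Int.cast_ne_zero.2 hm
  push_cast
  field_simp

/-- `‖exp ((π / m) i)‖ = 1`. -/
theorem norm_exp_pi_div_mul_I (m : ℤ) : ‖Complex.exp (((Real.pi / m : ℝ) : ℂ) * Complex.I)‖ = 1 :=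
  Complex.norm_exp_ofReal_mul_I _

include lam hlam hiso in
/-- **THE DISPLAYED-INTEGERS FORM (integers)** — under the LOCAL-TORUS SURJECTIVITY hypothesis `hsurj` (every unit
complex number is the `u₀`-weight (resp. the `u₁`-weight) of an element of `T_w` whose other weight is `1`; the typer-class
fact «`T_w ≅ U(1) × U(1)`» at a real CM place, NOT proved here), the K-type identity of
`integral_chi_archWitnessOf_ne_zero_iff_of_one` is EXACTLY `∀ w, eP′ w = eP w ∧ eM′ w = eM w`. -/
theorem forall_chi_mul_torusWeight'_inv_eq_one_iff_integers [MeasurableSpace (GA ((PlaneData.mixedRow q (a 0) (a 2)).withTransportedTorus 1 1 hgg' hg'g hgΩ))] (R : RTFData ((PlaneData.mixedRow q (a 0) (a 2)).withTransportedTorus 1 1 hgg' hg'g hgΩ))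
    (hall : ∀ w : InfinitePlace k, w.IsReal ∧ IsCMAt q w) (ha0 : a 0 ≠ 0) (ha2 : a 2 ≠ 0) (ha1 : a 1 ≠ 0)
    (ha3 : a 3 ≠ 0) (hchi : ∀ w, ChiMatchesAt ((PlaneData.mixedRow q (a 0) (a 2)).withTransportedTorus 1 1 hgg' hg'g hgΩ) q w (eP w) (eM w) R.chi)
    (hsurj : ∀ w : InfinitePlace k, ∀ z : ℂ, ‖z‖ = 1 →
      (∃ κ : torusT ((PlaneData.mixedRow q (a 0) (a 2)).withTransportedTorus 1 1 hgg' hg'g hgΩ), (κ : GA ((PlaneData.mixedRow q (a 0) (a 2)).withTransportedTorus 1 1 hgg' hg'g hgΩ)) ∈ localTorusAt ((PlaneData.mixedRow q (a 0) (a 2)).withTransportedTorus 1 1 hgg' hg'g hgΩ) w ∧ weightAt ((PlaneData.mixedRow q (a 0) (a 2)).withTransportedTorus 1 1 hgg' hg'g hgΩ) q w 0 (κ : GA ((PlaneData.mixedRow q (a 0) (a 2)).withTransportedTorus 1 1 hgg' hg'g hgΩ)) = z ∧ weightAt ((PlaneData.mixedRow q (a 0) (a 2)).withTransportedTorus 1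 1 hgg' hg'g hgΩ) q w 1 (κ : GA ((PlaneData.mixedRow q (a 0) (a 2)).withTransportedTorus 1 1 hgg' hg'g hgΩ)) = 1) ∧
      (∃ κ : torusT ((PlaneData.mixedRow q (a 0) (a 2)).withTransportedTorus 1 1 hgg' hg'g hgΩ), (κ : GA ((PlaneData.mixedRow q (a 0) (a 2)).withTransportedTorus 1 1 hgg' hg'g hgΩ)) ∈ localTorusAt ((PlaneData.mixedRow q (a 0) (a 2)).withTransportedTorus 1 1 hgg' hg'g hgΩ) w ∧ weightAt ((PlaneData.mixedRow q (a 0) (a 2)).withTransportedTorus 1 1 hgg' hg'g hgΩ) q w 0 (κ : GA ((PlaneData.mixedRow q (a 0) (a 2)).withTransportedTorus 1 1 hgg' hg'g hgΩ)) = 1 ∧ weightAt ((PlaneData.mixedRow q (a 0) (a 2)).withTransportedTorus 1 1 hgg' hg'g hgΩ) q w 1 (κ : GA ((PlaneData.mixedRow q (a 0) (a 2)).withTransportedTorus 1 1 hgg' hg'g hgΩ)) = z)) :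
    (∀ t : torusInf ((PlaneData.mixedRow q (a 0) (a 2)).withTransportedTorus 1 1 hgg' hg'g hgΩ), R.chi t * torusWeight' q a 1 1 hgg' hg'g hgΩ eP' eM' (((t : torusT ((PlaneData.mixedRow q (a 0) (a 2)).withTransportedTorus 1 1 hgg' hg'g hgΩ)) : GA ((PlaneData.mixedRow q (a 0) (a 2)).withTransportedTorus 1 1 hgg' hg'g hgΩ)))⁻¹ = 1) ↔
      ∀ w : InfinitePlace k, eP' w = eP w ∧ eM' w = eM w := by
  rw [forall_chi_mul_torusWeight'_inv_eq_one_iff_weights q a hgg' hg'g hgΩ lam hlam hiso eP eM eP' eM' R hall ha0 ha2 ha1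
    ha3 hchi]
  constructor
  · intro h w
    constructor
    · by_contra hne
      have hm : eP' w - eP w ≠ 0 := sub_ne_zero.2 hne
      obtain ⟨⟨κ, hκ, h0, h1⟩, -⟩ := hsurj w (Complex.exp (((Real.pi / (eP' w - eP w : ℤ) : ℝ) : ℂ) * Complex.I))
        (norm_exp_pi_div_mul_I _)
      have := h w κ hκ
      rw [h0, h1, _root_.one_zpow, mul_one, exp_pi_div_mul_I_zpow hm] at this
      exact absurd this (by norm_num)
    · by_contra hne
      have hm : eM' w - eM w ≠ 0 := sub_ne_zero.2 hne
      obtain ⟨-, ⟨κ, hκ, h0, h1⟩⟩ := hsurj w (Complex.exp (((Real.pi / (eM' w - eM w : ℤ) : ℝ) : ℂ) * Complex.I))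
        (norm_exp_pi_div_mul_I _)
      have := h w κ hκ
      rw [h0, h1, _root_.one_zpow, one_mul, exp_pi_div_mul_I_zpow hm] at this
      exact absurd this (by norm_num)
  · intro h w κ _
    rw [(h w).1, (h w).2, sub_self, sub_self, zpow_zero, zpow_zero, one_mul]

end Identity2

end Summit.Ventures.HodgeRepro.Tier4.Line4
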